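import Literature.Geometry.Kaehler.LocalFormsGlue
import Literature.Geometry.Kaehler.ManifoldFormsChart

/-!
# Helper `helper_glue_closedForms` of line `stable-seam-host` for crux `OrigamiFoldExistence`
(item stmt-SmoothPoincare4-7844; brick R1a of the round-seam rung)

Generic gluing of two closed `2`-forms along a two-set open cover of a smooth `4`-manifold `N`:
if `P`, `Q` are open with `P ∪ Q = N`, `u` is smooth and closed at the points of `P`, `v` is
smooth and closed at the points of `Q`, and `u = v` on `P ∩ Q`, then there is a smooth closed
`2`-form `s` on `N` with `s = u` on `P` and `s = v` on `Q`.

Proof: `s := MForm.glue P Q u v` of `Literature.Geometry.Kaehler.LocalFormsGlue` (the form equal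
to `u` on `P` and to `v` on `Q ∖ P`; exactness of the Mayer–Vietoris sequence of forms in the
middle, Bott–Tu (1982), Prop. 2.3).  Near a point of `P` (resp. `Q`) the glued form agrees with
`u` (resp. `v`) (`MForm.glue_eventuallyEq_left/right`), so smoothness and the exterior
derivative, both local (`MForm.SmoothAt.congr_of_eventuallyEq`,
`mextDeriv_glue_of_mem_left/right`), transfer from `u` and `v`; every point lies in `P` or `Q`.

## References

* R. Bott, L. W. Tu, *Differential Forms in Algebraic Topology*, GTM 82 (1982), §I.2, Prop. 2.3.
* F. W. Warner, *Foundations of Differentiable Manifolds and Lie Groups*, GTM 94 (1983), 2.20.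
-/

noncomputable section

-- the prescribed namespace `Summit.<P>.<Sub>.…` duplicates `SmoothPoincare4` (P = Sub)
set_option linter.dupNamespace false

open scoped Manifold ContDiff Topology
open Set Filter Literature.Geometry.Kaehler

namespace Summit.SmoothPoincare4.SmoothPoincare4.Theorems.OrigamiFoldExistence.StableSeamHost

/-- **Gluing closed forms along a two-set open cover.**  Let `N` be a smooth `4`-manifold,
`P`, `Q ⊆ N` open with `P ∪ Q = N`, and `u`, `v` two `2`-forms on `N` such that `u` is smooth
with `du = 0` at every point of `P`, `v` is smooth with `dv = 0` at every point of `Q`, and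
`u = v` on `P ∩ Q`.  Then there is a smooth closed `2`-form `s` on `N` with `s = u` on `P` and
`s = v` on `Q` (the glued form `MForm.glue P Q u v`; Bott–Tu (1982), Prop. 2.3, exactness of the
Mayer–Vietoris sequence of forms in the middle, together with the locality of smoothness and of
`d`). [cite: BottTu1982Forms, Prop. 2.3] -/
theorem helper_glue_closedForms : ∀ (N : Type) [TopologicalSpace N] [T2Space N] [SecondCountableTopology N] [ChartedSpace (EuclideanSpace ℝ (Fin 4)) N] [IsManifold (𝓡 4) ∞ N] (P Q : Set N) (u v : Literature.Geometry.Kaehler.MForm (𝓡 4) N ℝ 2), IsOpen P → IsOpen Q → P ∪ Q = Set.univ → (∀ x ∈ P, u.SmoothAt x) → (∀ x ∈ Q, v.SmoothAt x) → (∀ x ∈ P, Literature.Geometry.Kaehler.mextDeriv u x = 0) → (∀ x ∈ Q, Literature.Geometry.Kaehler.mextDeriv v x = 0) → (∀ x ∈ P ∩ Q, u x = v x) → ∃ s : Literature.Geometry.Kaehler.MForm (𝓡 4) N ℝ 2, Literature.Geometry.Kaehler.IsSmoothForm s ∧ Literature.Geometry.Kaehler.IsClosedForm s ∧ (∀ x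 ∈ P, s x = u x) ∧ (∀ x ∈ Q, s x = v x) := by
  intro N _ _ _ _ _ P Q u v hP hQ hPQ hu hv hdu hdv huv
  -- every point of `N` lies in `P` or in `Q`
  have hcov : ∀ x : N, x ∈ P ∨ x ∈ Q := fun x => by
    have hx : x ∈ P ∪ Q := hPQ ▸ mem_univ x
    exact hx
  refine ⟨MForm.glue P Q u v, ?_, ?_, fun x hx => MForm.glue_apply_of_mem_left u v hx,
    fun x hx => MForm.glue_apply_of_mem_right huv hx⟩
  · -- smoothness is local: near a point of `P` (resp. `Q`) the glued form is `u` (resp. `v`)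
    rw [isSmoothForm_iff_smoothAt]
    intro x
    rcases hcov x with hx | hx
    · exact (hu x hx).congr_of_eventuallyEq
        ((MForm.glue_eventuallyEq_left hP u v hx).mono fun _ h => h.symm)
    · exact (hv x hx).congr_of_eventuallyEq
        ((MForm.glue_eventuallyEq_right hQ huv hx).mono fun _ h => h.symm)
  · -- `d` is local: at a point of `P` (resp. `Q`) it is `du = 0` (resp. `dv = 0`)
    show mextDeriv (MForm.glue P Q u v) = 0
    funext x
    rcases hcov x with hx | hx
    · rw [mextDeriv_glue_of_mem_left hP u v hx, hdu x hx]
      rfl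
    · rw [mextDeriv_glue_of_mem_right hQ huv hx, hdv x hx]
      rfl

end Summit.SmoothPoincare4.SmoothPoincare4.Theorems.OrigamiFoldExistence.StableSeamHost

end
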